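import Summits.ResolutionOfSingularities.ResolutionOfSingularities.Theorems.EquisingularLiftEquisingularLiftNatTowerRationalDefs
import Literature.AlgebraicGeometry.Morphisms.CechH1Projective
import Mathlib.AlgebraicGeometry.Morphisms.Proper
import Mathlib.AlgebraicGeometry.Morphisms.Flat
import HarnessLib

/-!
# [OURS · L1 W4.5(b) · EL♮(3) · residue (T-j)] `RationalCarrierLiftAt` / `RationalCarrierLift` — THE RATIONAL-ROOT DEBT AT THE BIRTH OF A
# CARRIER CURVE, named: «a proper `O`-flat regular lift of a rational carrier `Z̃ ≅ ℙ¹` IS `ℙ¹_O` over `Spec O`»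

Crux chain w45b (cell `res-hironaka`, slot W4.5(b)), working crux **EL♮** = stmt-ResolutionOfSingularities-20038, child **EL♮(3)** =
stmt-ResolutionOfSingularities-20148, route EquisingularLift, line `sections`; rungs TOWER₃ / NOSE-TOWER₃ (registered stubs
`stub_elnat_coneTowerPointResolution`, `stub_elnat_ratNoseTowerResolution_of_subchainLift₃`). Written by res-L1-type-o6 g30 on res-L1-w45b-plan-1's
RULING 2026-08-27T20:17:26Z («(d)-at-birth is a GENUINE debt; TYPE `RationalCarrierLiftAt O k θ X σ q 𝒞` … carried by the curve-step root;
stub-2: `ruled_curveStep_root`'s `hCrat` binder at BIRTH becomes `(hCrat : RationalCarrierLiftAt …)`; 029 carries it to the assembly as residue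
(T-j) = ONE extra hypothesis of `hsub_reachTower_three` until discharged; DISCHARGE = NEED-FACT F-(T-j) → res-lit-6»).
HONEST FRAMING: «[OURS · L1 W4.5b · residue (T-j)] replaces the role of nothing printed; NOT a statement of the manuscript»; a NAMED HYPOTHESIS of
the programme's own tower, consumed only as a hypothesis, never asserted; AI-written, gate-checked, weaker than expert review. No `sorry`;
standard axioms. `--supports stmt-ResolutionOfSingularities-20148 --as helper`.

THE DEBT.  The input (d)/(R4) of the roots of res-L1-w45b-stub-2's `…NatTowerRuledRoots` (p562947) reads, verbatim,
`(hCrat : RationalCarrier (redSub F₉ Z₉ hZ₉) → ∃ e₁ : 𝒞.subscheme ≅ ProjCech.PP O 1, e₁.hom ≫ ProjCech.toSpec O 1 = 𝒞.subschemeι ≫ σ ≫ q)`.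
At a ROUND root it is transport (`…NatRationalCarrierTransport`, p566897: the new centre is isomorphic to the old one over the previous stage).
At the CURVE-STEP BIRTH the centre `𝒞 = 𝓢 ⊔ K` of res-D-pv-029's `Tower.inv₂_of_invKC_curveStep` is only CHARACTERISED by the clauses of
`TCPlus.InvKC` — exact reduced special fibre `𝒞·𝒪_{F₉} = 𝓘⟨Z₉⟩` (i), `O`-flat (ii), regular — and lives in a stage proper over `Spec O`; nobody
constructs it as a projective bundle.  So (d)-at-birth is the implication below, and this file NAMES it:
* `RationalCarrierLiftAt O k θ X σ q 𝒞` — for THIS centre: for every model square `(jG, tG)` of the stage `X` over `θ` and every closed `Z ⊆ G`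
  with `𝒞·𝒪_G = 𝓘⟨Z⟩`: `V(𝒞) → Spec O` proper and flat, `V(𝒞)` regular, `Z̃ ≅ ℙ¹_{k'}` (`RationalCarrier`) ⟹ `V(𝒞) ≅ ℙ¹_O` over `Spec O`;
* `RationalCarrierLift O k θ P q` — the same for EVERY stage `σ : X ⟶ P` and every centre (the ONE residue hypothesis (T-j) of the assembly);
* `RationalCarrierLift.liftAt` — projection to a stage; `RationalCarrierLiftAt.hCrat` / `RationalCarrierLiftAt.hCrat_of_isProper` — the EXTRACTION
  of the `hCrat` binder of `DirLift.ruled_curveStep_root` (properness of `V(𝒞) → Spec O` supplied, or derived from `[IsProper σ] [IsProper q]`);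
* `rationalCarrierLiftAt_of_isoPP` — sanity (non-vacuity of the conclusion's shape): a centre already identified with `ℙ¹_O` over `Spec O`
  satisfies the predicate.
VACUITY / TRUTH CHECK (one line each, as the typer rules ask).  Not trivially true: the conclusion is an isomorphism with `ℙ¹_O`.  Not trivially
false: `ℙ¹_O` itself satisfies it (`rationalCarrierLiftAt_of_isoPP`).  TRUE at the top of the chain, where `O := W(k)` is complete (`stub_wittRing`)
and `k = k̄` — informal route, NOT in the tree: `V(𝒞) → Spec O` is proper, flat, regular with smooth special fibre `ℙ¹_k`, hence smooth; a
`k`-point of the special fibre lifts to an `O`-section (Hensel, `O` henselian); a smooth proper genus-0 curve with a section is `ℙ(E)` for the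
rank-2 bundle `E = π_*𝒪(s)`, free over the local ring `O`, so `≅ ℙ¹_O` — the relative genus-0-with-section rigidity that res-L1-w45b-plan-1 filed as
NEED-FACT F-(T-j) (locators to READ: Görtz–Wedhorn II p.776 L25 → Lønsted–Kleiman, Compos. Math. 38 (1979) §3; the typer cites nothing from
memory).  FALSE for a general (non-henselian) discrete valuation ring `O` with algebraically closed residue field — an unramified non-split conic
(e.g., for `char k ≠ 2`, `x² − s·y² − (1+t)·z² = 0` over `O = k(s,t) ∩ k⟦t⟧`, `s ↦` a transcendental unit series: the quaternion algebra
`(s, 1+t)` ramifies along `1 + t = 0`, so no `K`-point) is a proper flat regular `O`-curve with special fibre `ℙ¹_k` and no `O`-section — so the residue must be discharged at the chain's CHOSEN `O`, never for arbitrary `O`; it is carried, not proved,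
by every tower theorem quantifying over `O`.

References (index only): p562947 (roots), p566897 (transport), …NatTowerRationalDefs (`RationalCarrier`), …NatSubchainSupplierInvKDefs
(`TCPlus.InvKC`, clauses (i)/(ii)), …NatTowerCurveStepCartier (`Tower.inv₂_of_invKC_curveStep`), Literature `Morphisms/CechH1Projective`
(`ProjCech.PP`, `ProjCech.toSpec`).
-/

set_option linter.dupNamespace false -- mandated namespace `Summit.<Summit>.<Problem>` of this single-conjunct summit

noncomputable section

open CategoryTheory AlgebraicGeometry TopologicalSpace
open Literature.AlgebraicGeometry.Resolution
open Literature.AlgebraicGeometry.Morphisms (ProjCech.PP ProjCech.toSpec)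
open AlgebraicGeometry.Scheme.IdealSheafData

namespace Summit.ResolutionOfSingularities.ResolutionOfSingularities.Cruxes.EquisingularLiftNat.Sections

/-! ## The named residue -/

/-- **`RationalCarrierLiftAt O k θ X σ q 𝒞` — residue (T-j) at ONE centre.**  For the stage `σ : X ⟶ P` over `q : P ⟶ Spec O` and the
centre `𝒞` on `X`: whenever `(jG, tG)` is a model square of `X` over the residue map `θ : O → k` and `Z ⊆ G` is closed with EXACT REDUCED
trace `𝒞·𝒪_G = 𝓘⟨Z⟩`, if `V(𝒞) → Spec O` is proper and flat, `V(𝒞)` is regular and the reduced carrier `Z̃` is a projective line over some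
field (`RationalCarrier`), then `V(𝒞)` is `ℙ¹_O` over `Spec O` — the `hCrat` binder of `DirLift.ruled_curveStep_root` at the birth of the
carrier curve.  [OURS · L1 W4.5b · residue (T-j)] replaces the role of nothing printed; informal route Hensel section + relative genus-0
rigidity (module docstring); consumed only as a HYPOTHESIS toward `stub_elnat_coneTowerPointResolution` /
`stub_elnat_ratNoseTowerResolution_of_subchainLift₃`; NOT a statement of the manuscript. -/
def RationalCarrierLiftAt (O : Type) [CommRing O] (k : Type) [Field k] (θ : O →+* k) {P : Scheme.{0}}
    (X : Scheme.{0}) (σ : X ⟶ P) (q : P ⟶ Spec (.of O)) (𝒞 : X.IdealSheafData) : Prop :=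
  ∀ (G : Scheme.{0}) (jG : G ⟶ X) (tG : G ⟶ Spec (.of k)),
    IsPullback jG tG (σ ≫ q) (Spec.map (CommRingCat.ofHom θ)) →
    ∀ (Z : Set G) (hZ : IsClosed Z), 𝒞.comap jG = vanishingIdeal (⟨Z, hZ⟩ : Closeds G) →
    IsProper (𝒞.subschemeι ≫ σ ≫ q) → Flat (𝒞.subschemeι ≫ σ ≫ q) → Scheme.IsRegular 𝒞.subscheme →
    RationalCarrier (redSub G Z hZ) →
      ∃ e₁ : 𝒞.subscheme ≅ ProjCech.PP O 1, e₁.hom ≫ ProjCech.toSpec O 1 = 𝒞.subschemeι ≫ σ ≫ q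

/-- **`RationalCarrierLift O k θ P q` — residue (T-j) for the WHOLE tower over `q : P ⟶ Spec O`**: `RationalCarrierLiftAt` at every stage
`σ : X ⟶ P` and every centre `𝒞` — the ONE extra hypothesis res-D-pv-029's assembly `hsub_reachTower_three` carries until the NEED-FACT F-(T-j)
discharges it at the chain's chosen `O`.  [OURS · L1 W4.5b · residue (T-j)]; hypothesis-only; NOT a statement of the manuscript. -/
def RationalCarrierLift (O : Type) [CommRing O] (k : Type) [Field k] (θ : O →+* k) (P : Scheme.{0}) (q : P ⟶ Spec (.of O)) : Prop :=
  ∀ (X : Scheme.{0}) (σ : X ⟶ P) (𝒞 : X.IdealSheafData), RationalCarrierLiftAt O k θ X σ q 𝒞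

variable {O : Type} [CommRing O] {k : Type} [Field k] {θ : O →+* k} {P : Scheme.{0}} {q : P ⟶ Spec (.of O)}

/-! ## Projection and extraction of the `hCrat` binder -/

/-- The tower residue specialises to every stage and centre. [OURS · pure logic]; NOT a statement of the manuscript. -/
theorem RationalCarrierLift.liftAt (h : RationalCarrierLift O k θ P q) (X : Scheme.{0}) (σ : X ⟶ P) (𝒞 : X.IdealSheafData) :
    RationalCarrierLiftAt O k θ X σ q 𝒞 :=
  h X σ 𝒞

/-- **EXTRACTION of the `hCrat` binder of `DirLift.ruled_curveStep_root` (p562947) at the birth of the carrier curve**, from the residue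
at the stage, the model square, the exact reduced trace `𝒞·𝒪_{F₉} = 𝓘⟨Z₉⟩`, and properness / flatness / regularity of `V(𝒞)` (the clauses
(i)/(ii) of `TCPlus.InvKC` plus the curve-step root's `hCreg`).  [OURS · pure logic] toward `stub_elnat_coneTowerPointResolution` /
`stub_elnat_ratNoseTowerResolution_of_subchainLift₃`; NOT a statement of the manuscript. -/
theorem RationalCarrierLiftAt.hCrat {X : Scheme.{0}} {σ : X ⟶ P} {𝒞 : X.IdealSheafData} (h : RationalCarrierLiftAt O k θ X σ q 𝒞)
    {F₉ : Scheme.{0}} {jG : F₉ ⟶ X} {tG : F₉ ⟶ Spec (.of k)} (hsq : IsPullback jG tG (σ ≫ q) (Spec.map (CommRingCat.ofHom θ)))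
    {Z₉ : Set F₉} {hZ₉ : IsClosed Z₉} (hCD : 𝒞.comap jG = vanishingIdeal (⟨Z₉, hZ₉⟩ : Closeds F₉))
    (hCproper : IsProper (𝒞.subschemeι ≫ σ ≫ q)) (hCflat : Flat (𝒞.subschemeι ≫ σ ≫ q)) (hCreg : Scheme.IsRegular 𝒞.subscheme) :
    RationalCarrier (redSub F₉ Z₉ hZ₉) →
      ∃ e₁ : 𝒞.subscheme ≅ ProjCech.PP O 1, e₁.hom ≫ ProjCech.toSpec O 1 = 𝒞.subschemeι ≫ σ ≫ q :=
  h F₉ jG tG hsq Z₉ hZ₉ hCD hCproper hCflat hCreg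

/-- The same with properness of `V(𝒞) → Spec O` DERIVED from the proper stage (`IsProper σ`, from `chain_isRegular`) and the proper
ambient `q` — the form in which `Tower.inv₂_of_invKC_curveStep` holds its data.  [OURS · pure logic]; NOT a statement of the manuscript. -/
theorem RationalCarrierLiftAt.hCrat_of_isProper {X : Scheme.{0}} {σ : X ⟶ P} {𝒞 : X.IdealSheafData}
    (h : RationalCarrierLiftAt O k θ X σ q 𝒞) [IsProper σ] [IsProper q]
    {F₉ : Scheme.{0}} {jG : F₉ ⟶ X} {tG : F₉ ⟶ Spec (.of k)} (hsq : IsPullback jG tG (σ ≫ q) (Spec.map (CommRingCat.ofHom θ)))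
    {Z₉ : Set F₉} {hZ₉ : IsClosed Z₉} (hCD : 𝒞.comap jG = vanishingIdeal (⟨Z₉, hZ₉⟩ : Closeds F₉))
    (hCflat : Flat (𝒞.subschemeι ≫ σ ≫ q)) (hCreg : Scheme.IsRegular 𝒞.subscheme) :
    RationalCarrier (redSub F₉ Z₉ hZ₉) →
      ∃ e₁ : 𝒞.subscheme ≅ ProjCech.PP O 1, e₁.hom ≫ ProjCech.toSpec O 1 = 𝒞.subschemeι ≫ σ ≫ q :=
  h.hCrat hsq hCD inferInstance hCflat hCreg

/-- The tower residue gives the `hCrat` binder at every curve-step birth directly. [OURS · pure logic]; NOT a statement of the manuscript. -/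
theorem RationalCarrierLift.hCrat_of_isProper (h : RationalCarrierLift O k θ P q) {X : Scheme.{0}} (σ : X ⟶ P) (𝒞 : X.IdealSheafData)
    [IsProper σ] [IsProper q]
    {F₉ : Scheme.{0}} {jG : F₉ ⟶ X} {tG : F₉ ⟶ Spec (.of k)} (hsq : IsPullback jG tG (σ ≫ q) (Spec.map (CommRingCat.ofHom θ)))
    {Z₉ : Set F₉} {hZ₉ : IsClosed Z₉} (hCD : 𝒞.comap jG = vanishingIdeal (⟨Z₉, hZ₉⟩ : Closeds F₉))
    (hCflat : Flat (𝒞.subschemeι ≫ σ ≫ q)) (hCreg : Scheme.IsRegular 𝒞.subscheme) :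
    RationalCarrier (redSub F₉ Z₉ hZ₉) →
      ∃ e₁ : 𝒞.subscheme ≅ ProjCech.PP O 1, e₁.hom ≫ ProjCech.toSpec O 1 = 𝒞.subschemeι ≫ σ ≫ q :=
  (h.liftAt X σ 𝒞).hCrat_of_isProper hsq hCD hCflat hCreg

/-! ## Sanity -/

/-- Sanity (the conclusion's shape is attainable): a centre already identified with `ℙ¹_O` over `Spec O` satisfies the residue at its stage,
whatever the model square and the trace. [OURS · pure logic]; NOT a statement of the manuscript. -/
theorem rationalCarrierLiftAt_of_isoPP {X : Scheme.{0}} (σ : X ⟶ P) (𝒞 : X.IdealSheafData)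
    (e : 𝒞.subscheme ≅ ProjCech.PP O 1) (he : e.hom ≫ ProjCech.toSpec O 1 = 𝒞.subschemeι ≫ σ ≫ q) :
    RationalCarrierLiftAt O k θ X σ q 𝒞 :=
  fun _ _ _ _ _ _ _ _ _ _ _ => ⟨e, he⟩

end Summit.ResolutionOfSingularities.ResolutionOfSingularities.Cruxes.EquisingularLiftNat.Sections

end
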